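import Literature.AlgebraicGeometry.Resolution.DerivativeIdeals
import Mathlib.RingTheory.Ideal.Colon
import HarnessLib

/-!
# Derivatives and controlled transforms on a blow-up chart (BGMW Lemma 3.5.3) — ring level

Topic: `Literature/AlgebraicGeometry/Resolution`. Bierstone–Grigoriev–Milman–Włodarczyk,
*Effective Hironaka resolution and its complexity*, arXiv:1206.3090, **Lemma 3.5.3** (Giraud,
Villamayor): "Let `(𝓘, μ)` be a marked ideal, `C ⊂ supp(𝓘, μ)` a smooth center, and `r ≤ μ`. Let
`σ : X ← X'` be a blow-up at `C`. Then `σᶜ(𝒟ʳ(𝓘, μ)) ⊆ 𝒟ʳ(σᶜ(𝓘, μ))`" (proof: "See the simple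
computations in [Vi2], [Wlod]"). This is the computation behind the persistence of maximal order
(Lemma 3.6.2), of maximal contact (Lemma 3.6.4 (3)–(6), Lemma 3.6.6) and of coefficient ideals
(Lemma 3.9.3) under admissible blow-ups.

Here is the case `r = 1` at the level of ONE CHART RING of the blow-up, in a coordinate-free and
characteristic-free form. Abstractly, a chart is an `R`-algebra `S` (think `S = R[I/a]`, the
affine blowup algebra of the centre `I` at `a ∈ I`) in which `I · S = (a)` with `a` a
non-zero-divisor, and such that for every `k`-derivation `δ` of `R` the derivation `a · δ` extends
to `S` (on `R[I/a]`: `a·δ(x/a) = δx − (x/a) δa`). If `J ⊆ I^μ` (`μ ≥ 1`; this is `𝓘 ⊆ 𝓘_C^μ`,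
BGMW Lemma 3.2.1, for `C ⊆ supp(𝓘, μ)`), the controlled transform of `J` on the chart is the
colon ideal `J' = (J S : a^μ)`, and that of `𝒟(J)` (multiplicity `μ − 1`) is `(𝒟(J) S : a^{μ-1})`.
PROVED: `(𝒟_k(J) · S : a^{μ-1}) ⊆ 𝒟_k((J · S : a^μ))` (`colon_map_derivIdeal_le_derivIdeal_colon`).
Computation: for `f ∈ J` write `f = a^μ f'` in `S`; then `f = a^{μ-1} · (a f')` and, applying the
extension `D` of `a δ`, `a · δf = D(a^μ f') = a^μ (μ δ(a) f' + D f')`, so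
`δ f = a^{μ-1} (μ δ(a) f' + D f') ∈ a^{μ-1} 𝒟(J')`; hence `𝒟(J) S ⊆ a^{μ-1} 𝒟(J')` and one cancels
the non-zero-divisor `a^{μ-1}`. No division by integers occurs: the lemma holds in every
characteristic.

* `colon_span_singleton_mul_eq` — `((x) · K : x) = K` for a non-zero-divisor `x`;
* `exists_eq_pow_mul_of_le_pow` — `f ∈ J ⊆ I^μ`, `I S = (a)` ⇒ `f = a^μ f'` with `f' ∈ (J S : a^μ)`;
* `map_derivIdeal_le_span_pow_mul_derivIdeal` — `𝒟(J) S ⊆ a^{μ-1} · 𝒟((J S : a^μ))`;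
* `colon_map_derivIdeal_le_derivIdeal_colon` — **Lemma 3.5.3 (`r = 1`) on a chart**.

## Sources

* [BGMW 2011] Lemma 3.5.3, Lemma 3.2.1, §3.2 (controlled transform of sections
  `g = y^{-μ}(f ∘ σ)`) (pp. 6–7, arXiv numbering). [BierstoneGrigorievMilmanWlodarczyk2011]
-/

namespace Literature.AlgebraicGeometry.Resolution

universe u v w

section Chart

variable (k : Type u) [CommRing k] {R : Type v} {S : Type w} [CommRing R] [CommRing S]
  [Algebra k R] [Algebra k S] [Algebra R S]

/-- Cancellation of a non-zero-divisor in a colon ideal: `((x) · K : x) = K`. [folklore] -/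
theorem colon_span_singleton_mul_eq {x : S} (hx : x ∈ nonZeroDivisors S) (K : Ideal S) :
    (Ideal.span {x} * K).colon {x} = K := by
  apply le_antisymm
  · intro s hs
    rw [Submodule.mem_colon_singleton, smul_eq_mul] at hs
    obtain ⟨b, hb, hxb⟩ := Ideal.mem_span_singleton_mul.mp hs
    have h0 : (b - s) * x = 0 := by rw [sub_mul, mul_comm b, hxb, sub_self]
    rw [mul_right_mem_nonZeroDivisors_eq_zero_iff hx, sub_eq_zero] at h0
    exact h0 ▸ hb
  · intro s hs
    rw [Submodule.mem_colon_singleton, smul_eq_mul]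
    exact Ideal.mem_span_singleton_mul.mpr ⟨s, hs, mul_comm x s⟩

variable {I J : Ideal R} {a : R} {μ : ℕ}

/-- On a chart where the centre `I` becomes principal, `I · S = (a)`, every `f ∈ J ⊆ I^μ` factors
as `f = a^μ · f'` with `f'` in the controlled transform `(J · S : a^μ)` (BGMW §3.2: "the function
`g = y^{-μ}(f ∘ σ) ∈ 𝓘(U')` is the controlled transform of `f`").
[cite: BierstoneGrigorievMilmanWlodarczyk2011, §3.2] -/
theorem exists_eq_pow_mul_of_le_pow (hI : I.map (algebraMap R S) = Ideal.span {algebraMap R S a})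
    (hJ : J ≤ I ^ μ) {f : R} (hf : f ∈ J) :
    ∃ f' ∈ (J.map (algebraMap R S)).colon {algebraMap R S a ^ μ},
      algebraMap R S f = algebraMap R S a ^ μ * f' := by
  have h1 : algebraMap R S f ∈ Ideal.span {algebraMap R S a ^ μ} := by
    have : algebraMap R S f ∈ (I ^ μ).map (algebraMap R S) := Ideal.mem_map_of_mem _ (hJ hf)
    rwa [Ideal.map_pow, hI, Ideal.span_singleton_pow] at this
  obtain ⟨f', hf'⟩ := Ideal.mem_span_singleton'.mp h1
  refine ⟨f', ?_, by rw [← hf', mul_comm]⟩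
  rw [Submodule.mem_colon_singleton, smul_eq_mul, hf']
  exact Ideal.mem_map_of_mem _ hf

/-- **The total transform of `𝒟(J)` is divisible by `a^{μ-1}` with quotient inside `𝒟` of the
controlled transform**: if `I · S = (a)` with `a` a non-zero-divisor of `S`, every `a · δ`
(`δ ∈ Der_k(R)`) extends to a `k`-derivation of `S`, and `J ⊆ I^μ` with `μ ≥ 1`, then
`𝒟_k(J) · S ⊆ a^{μ-1} · 𝒟_k((J · S : a^μ))`. [cite: BierstoneGrigorievMilmanWlodarczyk2011, Lemma 3.5.3] -/
theorem map_derivIdeal_le_span_pow_mul_derivIdeal (ha : algebraMap R S a ∈ nonZeroDivisors S)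
    (hI : I.map (algebraMap R S) = Ideal.span {algebraMap R S a})
    (hext : ∀ δ : Derivation k R R, ∃ D : Derivation k S S,
      ∀ r : R, D (algebraMap R S r) = algebraMap R S a * algebraMap R S (δ r))
    (hμ : 1 ≤ μ) (hJ : J ≤ I ^ μ) :
    (derivIdeal k J).map (algebraMap R S) ≤
      Ideal.span {algebraMap R S a ^ (μ - 1)} *
        derivIdeal k ((J.map (algebraMap R S)).colon {algebraMap R S a ^ μ}) := by
  obtain ⟨ν, rfl⟩ : ∃ ν, μ = ν + 1 := ⟨μ - 1, by omega⟩
  rw [Nat.add_sub_cancel]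
  set ι := algebraMap R S with hι
  set J' : Ideal S := (J.map ι).colon {ι a ^ (ν + 1)} with hJ'
  rw [Ideal.map_le_iff_le_comap, derivIdeal_le_iff]
  constructor
  · intro f hf
    obtain ⟨f', hf'J, hff'⟩ := exists_eq_pow_mul_of_le_pow hI hJ hf
    rw [Ideal.mem_comap]
    change ι f ∈ _
    rw [show ι f = ι a ^ (ν + 1) * f' from hff', pow_succ, mul_assoc]
    exact Ideal.mul_mem_mul (Ideal.mem_span_singleton_self _)
      (le_derivIdeal k J' (J'.mul_mem_left _ hf'J))
  · intro δ f hf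
    obtain ⟨f', hf'J, hff'⟩ := exists_eq_pow_mul_of_le_pow hI hJ hf
    obtain ⟨D, hD⟩ := hext δ
    rw [Ideal.mem_comap]
    change ι (δ f) ∈ _
    have hff'' : ι f = ι a ^ (ν + 1) * f' := hff'
    -- `a · δf = D(f) = D(a^{ν+1} f') = a^{ν+1} ((ν+1) δ(a) f' + D f')`
    have hDa : D (ι a ^ (ν + 1)) = ((ν + 1 : ℕ) : S) * ι a ^ (ν + 1) * ι (δ a) := by
      rw [Derivation.leibniz_pow, hD, Nat.add_sub_cancel, nsmul_eq_mul, smul_eq_mul]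
      ring
    have h1 : ι a * ι (δ f) =
        ι a * (ι a ^ ν * (((ν + 1 : ℕ) : S) * ι (δ a) * f' + D f')) := by
      rw [← hD, hff'', Derivation.leibniz, hDa, smul_eq_mul, smul_eq_mul]
      ring
    have h2 : ι (δ f) = ι a ^ ν * (((ν + 1 : ℕ) : S) * ι (δ a) * f' + D f') := by
      have h0 : (ι (δ f) - ι a ^ ν * (((ν + 1 : ℕ) : S) * ι (δ a) * f' + D f')) * ι a = 0 := by
        rw [sub_mul, mul_comm (ι (δ f)), mul_comm (ι a ^ ν * _), h1, sub_self]
      rwa [mul_right_mem_nonZeroDivisors_eq_zero_iff ha, sub_eq_zero] at h0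
    rw [h2]
    refine Ideal.mul_mem_mul (Ideal.mem_span_singleton_self _) (Ideal.add_mem _ ?_ ?_)
    · exact le_derivIdeal k J' (J'.mul_mem_left _ hf'J)
    · exact apply_mem_derivIdeal k D hf'J

/-- **BGMW Lemma 3.5.3 for `r = 1`, on a chart of the blow-up** ("`σᶜ(𝒟(𝓘, μ)) ⊆ 𝒟(σᶜ(𝓘, μ))`",
Giraud, Villamayor): with `S`, `a`, `I`, `J`, `μ` as in `map_derivIdeal_le_span_pow_mul_derivIdeal`,
the controlled transform `(𝒟(J) · S : a^{μ-1})` of `(𝒟(J), μ - 1)` is contained in the derivative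
ideal `𝒟((J · S : a^μ))` of the controlled transform of `(J, μ)`. Characteristic-free.
[cite: BierstoneGrigorievMilmanWlodarczyk2011, Lemma 3.5.3] -/
theorem colon_map_derivIdeal_le_derivIdeal_colon (ha : algebraMap R S a ∈ nonZeroDivisors S)
    (hI : I.map (algebraMap R S) = Ideal.span {algebraMap R S a})
    (hext : ∀ δ : Derivation k R R, ∃ D : Derivation k S S,
      ∀ r : R, D (algebraMap R S r) = algebraMap R S a * algebraMap R S (δ r))
    (hμ : 1 ≤ μ) (hJ : J ≤ I ^ μ) :
    ((derivIdeal k J).map (algebraMap R S)).colon {algebraMap R S a ^ (μ - 1)} ≤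
      derivIdeal k ((J.map (algebraMap R S)).colon {algebraMap R S a ^ μ}) := by
  have hpow : algebraMap R S a ^ (μ - 1) ∈ nonZeroDivisors S := pow_mem ha _
  rw [← colon_span_singleton_mul_eq hpow
    (derivIdeal k ((J.map (algebraMap R S)).colon {algebraMap R S a ^ μ}))]
  intro s hs
  rw [Submodule.mem_colon_singleton] at hs ⊢
  exact map_derivIdeal_le_span_pow_mul_derivIdeal k ha hI hext hμ hJ hs

end Chart

end Literature.AlgebraicGeometry.Resolution
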